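import Summits.HubbardSuperconductivity.HubbardSuperconductivity.Theorems.TwSeededEnsembleEquivalence.Negative.DefectFloor
import Summits.HubbardSuperconductivity.HubbardSuperconductivity.Theorems.TwSeededEnsembleEquivalence.Negative.CouplingTransfer
import Summits.HubbardSuperconductivity.HubbardSuperconductivity.Theorems.TwSeededEnsembleEquivalence.Negative.HalfFillingCounting

/-!
# Crux `TwSeededEnsembleEquivalenceR` (stmt-HubbardSuperconductivity-15581) — the doping window is load-bearing:
# the repaired crux's BODY is FALSE at half filling (`δ = 0`)

Negative-side support lemmas (refuter, cdisprove gen 1 on the REPAIRED thermal-window crux of route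
`ThermalWedge`), sorry-free and definition-free. TEMPLATE I of the predecessor crux's disprover (gen 4; the
band counting landed as `Negative/HalfFillingCounting.lean`, the assembly only lived in the crux work file)
re-assembled for the new quantifier shape `∃ a K' U₀ ∀ U ≤ U₀ ∀ g ∈ [K'U, 1/10] ∀ β ∈ [1, e^{a/U}]`.

* `hullGap_halfFilling_ge` — the T = 0 HULL GAP AT HALF FILLING of the d-wave-seeded repulsive torus: for even
  `L ≥ 3`, `U, g ≥ 0`, a slope `−4 ≤ μ < 0` with `1 ≤ (|μ|/2)L/(16π)` and every sector `K ≠ ⊥` of `L²`-particle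
  vectors, `minE(Hcan(U,g), K) − μL² − E₀(Hgc(U,μ,g)) ≥ (|μ|³/(2048π²) − U − 32g)·L²`
  (free count near the half-filled Fermi level + antiperiodicity `ε(k+(L/2,L/2)) = −ε(k)`, transported to
  `(U, g) ≠ 0` by the landed coupling/seed transfers, Templates E/F).
* `twSeededEnsembleEquivalenceR_body_false_at_halfFilling` — KILL OF THE `δ = 0` NEIGHBOUR: the body of
  `TwSeededEnsembleEquivalenceR` with `δ := 0` is FALSE. Against any window `[μ₁,μ₂] ⊂ (−4,0)` and any
  `(a, K', U₀)` the disprover plays `κ := |μ₂|³/(2048π²)`, `β := max 1 (8 log 4/κ)` (allowance `≤ κ/8`),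
  `U := min U₀ (min (κ/4) (min (κ/(128K')) (min (1/(10K')) (a/(log β + 1)))))` — small enough that `β ≤ e^{a/U}`
  and that the smallest admissible seed `g := K'U` has `32g ≤ κ/4` — and even `L → ∞`; then
  `D_L(β,μ) ≥ [hull gap]/L² ≥ κ − U − 32g ≥ κ/2 > κ/8 + κ/8 ≥ log 4/β + ε`.
  Physically: at half filling the canonical chemical potential is `U/2 > 0` (particle–hole symmetry), outside
  every negative window; the thermal window `β ≤ e^{a/U}` does not rescue the statement because `U → 0⁺`
  opens it to any prescribed `β`. So the hypothesis `1/10 ≤ δ` of the repaired crux is load-bearing (as it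
  was for the crux as filed), and the kill pipeline "T = 0 hull gap ⟹ ¬(body)" is road-tested end to end in
  the repaired shape: a real kill of `TwSeededEnsembleEquivalenceR` would differ only in the physics input
  (a hull gap at density `1 − δ ∈ [0.6, 0.9]` NOT exponentially small in `1/U`) replacing the free count.
-/

set_option linter.dupNamespace false

namespace Summit.HubbardSuperconductivity.HubbardSuperconductivity.Theorems.TwSeededEnsembleEquivalenceR.Negative

open Matrix Literature.MathematicalPhysics.QuantumLattice Literature.Probability.LatticeModels
open Summit.HubbardSuperconductivity.HubbardSuperconductivity.Theorems.TwSeededEnsembleEquivalence.Negative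
open scoped ComplexOrder Matrix.Norms.L2Operator

noncomputable section

/-- Pure lower bound for seeded sector energies: `minE(H₀(U), K) ≤ minE(Hcan(U,g), K) + 32gL²`
(`K ≠ ⊥`, `g ≥ 0`; `‖Δ_d‖² ≤ 32L⁴`). [folklore] -/
theorem minEnergyOn_pure_le_seededCan_add (L : ℕ) [NeZero L] (U : ℝ) {g : ℝ} (hg : 0 ≤ g)
    (K : Submodule ℂ (Fock (Orb (FermionTorus 2 L)))) (hK : K ≠ ⊥) :
    (hubbardTorus 2 L 1 U).minEnergyOn K ≤
      (hubbardTorus 2 L 1 U - ((g / (L : ℝ) ^ 2 : ℝ) : ℂ) •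
        ((pairField dWaveFormFactor L)ᴴ * pairField dWaveFormFactor L)).minEnergyOn K + 32 * g * (L : ℝ) ^ 2 := by
  obtain ⟨v, hvK, hv0⟩ := (Submodule.ne_bot_iff K).1 hK
  obtain ⟨c, -, hc1⟩ := exists_smul_unit hv0
  rw [← sub_le_iff_le_add]
  refine le_csInf ⟨_, c • v, K.smul_mem c hvK, hc1, rfl⟩ ?_
  rintro E ⟨φ, hφK, hφ1, rfl⟩
  have hH : (hubbardTorus 2 L 1 U).IsHermitian := by
    rw [← hubbardTorusWith_zero]; exact isHermitian_hubbardTorusWith L 1 U 0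
  have h1 := minEnergyOn_le_rayleigh_of_mem hH K hφK hφ1
  have h2 := re_rayleigh_pure_le_Hcan_add L (U := U) hg hφ1
  linarith

/-- `E₀(Hgc(U,μ,g)) ≤ E₀(K⁰_μ) + UL²` for `U, g ≥ 0` (the seed lowers the grand-canonical ground energy, the
repulsion raises it by at most `UL²`). [folklore] -/
theorem groundEnergy_seededGC_le_free_add (L : ℕ) [NeZero L] {U g : ℝ} (hU : 0 ≤ U) (hg : 0 ≤ g) (μ : ℝ) :
    (hubbardTorusWith 2 L 1 U μ - ((g / (L : ℝ) ^ 2 : ℝ) : ℂ) •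
        ((pairField dWaveFormFactor L)ᴴ * pairField dWaveFormFactor L)).groundEnergy ≤
      (hubbardTorusWith 2 L 1 0 μ).groundEnergy + U * (L : ℝ) ^ 2 := by
  have h1 := groundEnergy_seededGC_anti L 0 μ (g₀ := 0) hg
  have h2 := groundEnergy_seededGC_le_add_U L hU μ g
  have h0 : hubbardTorusWith 2 L 1 0 μ - ((0 / (L : ℝ) ^ 2 : ℝ) : ℂ) •
      ((pairField dWaveFormFactor L)ᴴ * pairField dWaveFormFactor L) = hubbardTorusWith 2 L 1 0 μ := by
    rw [zero_div, Complex.ofReal_zero, zero_smul, sub_zero]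
  rw [h0] at h1
  rw [sub_zero] at h2
  linarith

/-- **TEMPLATE I — THE HULL GAP AT HALF FILLING** (d-wave-seeded repulsive torus). For even `L ≥ 3`,
`U, g ≥ 0`, a slope `−4 ≤ μ < 0` with `1 ≤ (|μ|/2)L/(16π)` and every sector `K ≠ ⊥` of `L²`-particle vectors:
`minE(Hcan(U,g), K) − μL² − E₀(Hgc(U,μ,g)) ≥ (|μ|³/(2048π²) − U − 32g)·L²`. [folklore] -/
theorem hullGap_halfFilling_ge (L : ℕ) [NeZero L] (hL3 : 3 ≤ L) (hLe : Even L) {U g μ : ℝ} (hU : 0 ≤ U)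
    (hg : 0 ≤ g) (hμ : μ < 0) (hμ4 : -4 ≤ μ) (hLm : 1 ≤ -μ / 2 * L / (16 * Real.pi))
    (K : Submodule ℂ (Fock (Orb (FermionTorus 2 L)))) (hK : K ≠ ⊥) (hKN : ∀ ψ ∈ K, IsNParticle (L ^ 2) ψ) :
    ((-μ) ^ 3 / (2048 * Real.pi ^ 2) - U - 32 * g) * (L : ℝ) ^ 2 ≤
      (hubbardTorus 2 L 1 U - ((g / (L : ℝ) ^ 2 : ℝ) : ℂ) •
          ((pairField dWaveFormFactor L)ᴴ * pairField dWaveFormFactor L)).minEnergyOn K - μ * (L : ℝ) ^ 2 -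
        (hubbardTorusWith 2 L 1 U μ - ((g / (L : ℝ) ^ 2 : ℝ) : ℂ) •
          ((pairField dWaveFormFactor L)ᴴ * pairField dWaveFormFactor L)).groundEnergy := by
  have hLpos : (0 : ℝ) < (L : ℝ) ^ 2 := cast_sq_pos_of_neZero L
  -- (U, g) → (0, g) → (0, 0) on the sector side
  have h1 := minEnergyOn_seededCan_mono_U L hU g K hK
  have h2 := minEnergyOn_pure_le_seededCan_add L 0 hg K hK
  -- trivial half at U = g = μ = 0
  have h3 := groundEnergy_seededGC_add_le_minEnergyOn L 0 0 0 K hK hKN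
  have h3' : (hubbardTorusWith 2 L 1 0 0).groundEnergy ≤ (hubbardTorus 2 L 1 0).minEnergyOn K := by
    have e1 : hubbardTorusWith 2 L 1 0 0 - ((0 / (L : ℝ) ^ 2 : ℝ) : ℂ) •
        ((pairField dWaveFormFactor L)ᴴ * pairField dWaveFormFactor L) = hubbardTorusWith 2 L 1 0 0 := by
      rw [zero_div, Complex.ofReal_zero, zero_smul, sub_zero]
    have e2 : hubbardTorus 2 L 1 0 - ((0 / (L : ℝ) ^ 2 : ℝ) : ℂ) •
        ((pairField dWaveFormFactor L)ᴴ * pairField dWaveFormFactor L) = hubbardTorus 2 L 1 0 := by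
      rw [zero_div, Complex.ofReal_zero, zero_smul, sub_zero]
    rw [e1, e2, zero_mul, add_zero] at h3
    exact h3
  -- (U, g) → (0, 0) on the grand-canonical side
  have h4 := groundEnergy_seededGC_le_free_add L hU hg μ
  rw [groundEnergy_hubbardTorusWith_zero hL3 0] at h3'
  rw [groundEnergy_hubbardTorusWith_zero hL3 μ] at h4
  set m : ℝ := -μ with hm
  have hm0 : 0 ≤ m := by rw [hm]; linarith
  have hsub : ∀ k : TorusSite 2 L, torusBand L k - μ = torusBand L k + m := fun k => by rw [hm]; ring
  simp only [sub_zero] at h3'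
  simp only [hsub] at h4
  -- the free count at half filling
  have h5 := free_legendre_defect_halfFilling_ge hLe hm0
  have h6 := sq_le_card_filter_abs_torusBand_le (L := L) (a := m / 2) (by rw [hm]; linarith)
    (by rw [hm]; linarith) hLm
  have hcnt : m ^ 3 / (2048 * Real.pi ^ 2) * (L : ℝ) ^ 2 ≤
      m / 2 * ((Finset.univ.filter fun k : TorusSite 2 L => |torusBand L k| ≤ m / 2).card : ℝ) := by
    have : m / 2 * (m / 2 * L / (16 * Real.pi)) ^ 2 = m ^ 3 / (2048 * Real.pi ^ 2) * (L : ℝ) ^ 2 := by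
      field_simp; ring
    rw [← this]
    exact mul_le_mul_of_nonneg_left h6 (by positivity)
  linarith [h1, h2, h3', h4, h5, hcnt, hLpos, hm]

/-- The crux's particle number at `δ = 0` and even `L`: `2⌊(1 − 0)L²/2⌋₊ = L²`. -/
theorem two_mul_floor_halfFilling_of_even {L : ℕ} (hL : Even L) :
    2 * ⌊(1 - (0 : ℝ)) * (L : ℝ) ^ 2 / 2⌋₊ = L ^ 2 := by
  obtain ⟨M, hM⟩ := hL
  have h : (1 - (0 : ℝ)) * (L : ℝ) ^ 2 / 2 = ((2 * M ^ 2 : ℕ) : ℝ) := by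
    rw [hM]; push_cast; ring
  rw [h, Nat.floor_natCast, hM]; ring

/-- **Template I, kill form for the repaired crux: the doping window is load-bearing.** The BODY of
`TwSeededEnsembleEquivalenceR` at `δ = 0` (half filling) is FALSE: for every window `[μ₁,μ₂] ⊂ (−4,0)` and
every `(a, K', U₀)`, the disprover's `β = max 1 (8 log 4/κ)`, `U → 0⁺` (with `β ≤ e^{a/U}`), `g = K'U` and
even `L → ∞` (`κ = |μ₂|³/(2048π²)`) violate the inequality. The thermal window does not help: it opens to
every prescribed `β` as `U → 0⁺`. [folklore] -/
theorem twSeededEnsembleEquivalenceR_body_false_at_halfFilling :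
    ¬ (∃ μ₁ μ₂ : ℝ, -4 < μ₁ ∧ μ₁ ≤ μ₂ ∧ μ₂ < 0 ∧
        ∃ a K' U₀ : ℝ, 0 < a ∧ 0 < K' ∧ 0 < U₀ ∧ ∀ U ∈ Set.Ioc (0 : ℝ) U₀, ∀ g ∈ Set.Icc (K' * U) (1 / 10),
          ∀ β : ℝ, 1 ≤ β → β ≤ Real.exp (a / U) →
            ∃ μ ∈ Set.Icc μ₁ μ₂, ∀ ε : ℝ, 0 < ε → ∃ L₀ : ℕ, ∀ (L : ℕ) [NeZero L], L₀ ≤ L →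
              (((hubbardTorus 2 L 1 U - ((g / (L : ℝ) ^ 2 : ℝ) : ℂ) •
                ((pairField dWaveFormFactor L)ᴴ * pairField dWaveFormFactor L))).minEnergyOn
                  (szSector (Λ := FermionTorus 2 L) (2 * ⌊(1 - (0 : ℝ)) * (L : ℝ) ^ 2 / 2⌋₊) 0) / (L : ℝ) ^ 2) +
                (Real.log (Matrix.partitionFn β (hubbardTorusWith 2 L 1 U μ - ((g / (L : ℝ) ^ 2 : ℝ) : ℂ) •
                  ((pairField dWaveFormFactor L)ᴴ * pairField dWaveFormFactor L))).re / (β * (L : ℝ) ^ 2)) -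
                μ * ((2 * ⌊(1 - (0 : ℝ)) * (L : ℝ) ^ 2 / 2⌋₊) : ℝ) / (L : ℝ) ^ 2 ≤ Real.log 4 / β + ε) := by
  rintro ⟨μ₁, μ₂, hμ₁, hμ₁₂, hμ₂, a, K', U₀, ha, hK', hU₀, H⟩
  have hπ := Real.pi_pos
  set m : ℝ := -μ₂ with hmdef
  have hm : 0 < m := by rw [hmdef]; linarith
  set κ : ℝ := m ^ 3 / (2048 * Real.pi ^ 2) with hκ
  have hκpos : 0 < κ := by positivity
  -- the witness temperature
  set β : ℝ := max 1 (8 * Real.log 4 / κ) with hβdef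
  have hβ1 : 1 ≤ β := le_max_left _ _
  have hβpos : 0 < β := lt_of_lt_of_le one_pos hβ1
  have hlog4 : 0 < Real.log 4 := Real.log_pos (by norm_num)
  have hslack : Real.log 4 / β ≤ κ / 8 := by
    rw [div_le_iff₀ hβpos]
    have : 8 * Real.log 4 / κ ≤ β := le_max_right _ _
    rw [div_le_iff₀ hκpos] at this
    linarith
  have hlog : 0 ≤ Real.log β := Real.log_nonneg hβ1
  have hlog1 : 0 < Real.log β + 1 := by linarith
  -- the witness coupling `U → 0⁺` and seed `g = K'U`
  set U : ℝ := min U₀ (min (κ / 4) (min (κ / (128 * K')) (min (1 / (10 * K')) (a / (Real.log β + 1)))))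
    with hUdef
  have hUpos : 0 < U := by
    rw [hUdef]
    refine lt_min hU₀ (lt_min (by positivity) (lt_min (by positivity) (lt_min (by positivity) (by positivity))))
  have hUU₀ : U ≤ U₀ := min_le_left _ _
  have hUκ : U ≤ κ / 4 := (min_le_right _ _).trans (min_le_left _ _)
  have hUκK : U ≤ κ / (128 * K') := (min_le_right _ _).trans ((min_le_right _ _).trans (min_le_left _ _))
  have hUK : U ≤ 1 / (10 * K') :=
    (min_le_right _ _).trans ((min_le_right _ _).trans ((min_le_right _ _).trans (min_le_left _ _)))
  have hUa : U ≤ a / (Real.log β + 1) :=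
    (min_le_right _ _).trans ((min_le_right _ _).trans ((min_le_right _ _).trans (min_le_right _ _)))
  have hUm : U ∈ Set.Ioc (0 : ℝ) U₀ := ⟨hUpos, hUU₀⟩
  have hg32 : 32 * (K' * U) ≤ κ / 4 := by
    have h := mul_le_mul_of_nonneg_left hUκK hK'.le
    have e : K' * (κ / (128 * K')) = κ / 128 := by field_simp
    rw [e] at h
    linarith
  have hgm : K' * U ∈ Set.Icc (K' * U) (1 / 10) := by
    refine ⟨le_rfl, ?_⟩
    have h := mul_le_mul_of_nonneg_left hUK hK'.le
    have e : K' * (1 / (10 * K')) = 1 / 10 := by field_simp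
    linarith [h, e.le, e.ge]
  have hβexp : β ≤ Real.exp (a / U) := by
    have h1 : Real.log β ≤ a / U := by
      rw [le_div_iff₀ hUpos]
      have h2 : U * (Real.log β + 1) ≤ a := by
        have := mul_le_mul_of_nonneg_right hUa hlog1.le
        rwa [div_mul_cancel₀ _ hlog1.ne'] at this
      nlinarith
    calc β = Real.exp (Real.log β) := (Real.exp_log hβpos).symm
      _ ≤ Real.exp (a / U) := Real.exp_le_exp.2 h1
  obtain ⟨μ, hμm, hμ⟩ := H U hUm (K' * U) hgm β hβ1 hβexp
  obtain ⟨L₀, hL₀⟩ := hμ (κ / 8) (by positivity)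
  -- an even side `L ≥ max(L₀, 64π/m, 4)`
  obtain ⟨L₁, hL₁⟩ := exists_nat_gt (64 * Real.pi / m)
  set L : ℕ := 2 * (max (max L₀ L₁) 2) with hLdef
  have hLe : Even L := ⟨max (max L₀ L₁) 2, by rw [hLdef]; ring⟩
  have hL0le : L₀ ≤ L := by
    have : L₀ ≤ max (max L₀ L₁) 2 := (le_max_left _ _).trans (le_max_left _ _)
    omega
  have hL4 : 4 ≤ L := by have : 2 ≤ max (max L₀ L₁) 2 := le_max_right _ _; omega
  have hL1le : (L₁ : ℝ) ≤ L := by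
    have : L₁ ≤ L := by
      have : L₁ ≤ max (max L₀ L₁) 2 := (le_max_right _ _).trans (le_max_left _ _)
      omega
    exact_mod_cast this
  haveI : NeZero L := ⟨by omega⟩
  have hLr : (0 : ℝ) < L := by exact_mod_cast (show 0 < L by omega)
  have hLpos : (0 : ℝ) < (L : ℝ) ^ 2 := cast_sq_pos_of_neZero L
  have hinst := hL₀ L hL0le
  have hμneg : μ < 0 := lt_of_le_of_lt hμm.2 hμ₂
  have hμ4 : -4 ≤ μ := by linarith [hμm.1]
  have hmle : m ≤ -μ := by rw [hmdef]; linarith [hμm.2]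
  have hLm : 1 ≤ -μ / 2 * L / (16 * Real.pi) := by
    rw [le_div_iff₀ (by positivity)]
    have h1 : 64 * Real.pi / m < L := hL₁.trans_le hL1le
    rw [div_lt_iff₀ hm] at h1
    nlinarith [mul_nonneg (sub_nonneg.2 hmle) hLr.le]
  -- the sector at δ = 0 is the half-filled one, `N = L²`
  have hNL : 2 * ⌊(1 - (0 : ℝ)) * (L : ℝ) ^ 2 / 2⌋₊ = L ^ 2 := two_mul_floor_halfFilling_of_even hLe
  have hNLr : (2 : ℝ) * (⌊(1 - (0 : ℝ)) * (L : ℝ) ^ 2 / 2⌋₊ : ℝ) = (L : ℝ) ^ 2 := by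
    have h : ((2 * ⌊(1 - (0 : ℝ)) * (L : ℝ) ^ 2 / 2⌋₊ : ℕ) : ℝ) = ((L ^ 2 : ℕ) : ℝ) := by rw [hNL]
    push_cast at h
    linarith
  have hKne : szSector (Λ := FermionTorus 2 L) (L ^ 2) 0 ≠ ⊥ := by
    obtain ⟨M, hM⟩ := hLe
    have hsq : L ^ 2 = 2 * (2 * M ^ 2) := by rw [hM]; ring
    have hn : 2 * M ^ 2 ≤ Fintype.card (FermionTorus 2 L) := by rw [card_fermionTorus, hsq]; omega
    obtain ⟨⟨ψ, hψS, hψ0, -⟩, -⟩ := szSector_groundState (fermionTorusGraph 2 L) 1 0 hn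
    rw [hsq, Submodule.ne_bot_iff]
    exact ⟨ψ, hψS, hψ0⟩
  have hKN : ∀ ψ ∈ szSector (Λ := FermionTorus 2 L) (L ^ 2) 0, IsNParticle (L ^ 2) ψ :=
    fun ψ hψ => ((mem_szSector_iff _ _ ψ).1 hψ).1
  have hgap := hullGap_halfFilling_ge L (by omega) hLe (U := U) (g := K' * U) hUpos.le
    (mul_nonneg hK'.le hUpos.le) hμneg hμ4 hLm (szSector (Λ := FermionTorus 2 L) (L ^ 2) 0) hKne hKN
  rw [hNL, hNLr] at hinst
  set A := (hubbardTorus 2 L 1 U - ((K' * U / (L : ℝ) ^ 2 : ℝ) : ℂ) •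
      ((pairField dWaveFormFactor L)ᴴ * pairField dWaveFormFactor L)).minEnergyOn
      (szSector (Λ := FermionTorus 2 L) (L ^ 2) 0) with hA
  have hZ : -(β * (hubbardTorusWith 2 L 1 U μ - ((K' * U / (L : ℝ) ^ 2 : ℝ) : ℂ) •
      ((pairField dWaveFormFactor L)ᴴ * pairField dWaveFormFactor L)).groundEnergy) ≤
      Real.log ((hubbardTorusWith 2 L 1 U μ - ((K' * U / (L : ℝ) ^ 2 : ℝ) : ℂ) •
      ((pairField dWaveFormFactor L)ᴴ * pairField dWaveFormFactor L)).partitionFn β).re :=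
    neg_mul_groundEnergy_le_log_partitionFn (isHermitian_seededGC L U μ (K' * U)) β
  set E := (hubbardTorusWith 2 L 1 U μ - ((K' * U / (L : ℝ) ^ 2 : ℝ) : ℂ) •
      ((pairField dWaveFormFactor L)ᴴ * pairField dWaveFormFactor L)).groundEnergy with hE
  set Z := Real.log ((hubbardTorusWith 2 L 1 U μ - ((K' * U / (L : ℝ) ^ 2 : ℝ) : ℂ) •
      ((pairField dWaveFormFactor L)ᴴ * pairField dWaveFormFactor L)).partitionFn β).re with hZdef
  have hZ' : -(E / (L : ℝ) ^ 2) ≤ Z / (β * (L : ℝ) ^ 2) := by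
    rw [le_div_iff₀ (mul_pos hβpos hLpos)]
    have : -(E / (L : ℝ) ^ 2) * (β * (L : ℝ) ^ 2) = -(β * E) := by
      field_simp
    linarith
  have hκ' : κ ≤ (-μ) ^ 3 / (2048 * Real.pi ^ 2) := by
    rw [hκ]; apply div_le_div_of_nonneg_right _ (by positivity)
    exact pow_le_pow_left₀ hm.le hmle 3
  have hgap' : κ / 2 ≤ A / (L : ℝ) ^ 2 - μ - E / (L : ℝ) ^ 2 := by
    have h1 : (κ / 2) * (L : ℝ) ^ 2 ≤ A - μ * (L : ℝ) ^ 2 - E := by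
      refine le_trans ?_ hgap
      apply mul_le_mul_of_nonneg_right _ hLpos.le
      linarith
    have h2 := div_le_div_of_nonneg_right h1 hLpos.le
    rw [mul_div_assoc, div_self hLpos.ne', mul_one] at h2
    have e : (A - μ * (L : ℝ) ^ 2 - E) / (L : ℝ) ^ 2 = A / (L : ℝ) ^ 2 - μ - E / (L : ℝ) ^ 2 := by
      field_simp
    rw [e] at h2
    exact h2
  have hinst' : A / (L : ℝ) ^ 2 + Z / (β * (L : ℝ) ^ 2) - μ * (L : ℝ) ^ 2 / (L : ℝ) ^ 2 ≤
      Real.log 4 / β + κ / 8 := hinst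
  rw [mul_div_assoc, div_self hLpos.ne', mul_one] at hinst'
  linarith

end

end Summit.HubbardSuperconductivity.HubbardSuperconductivity.Theorems.TwSeededEnsembleEquivalenceR.Negative
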